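import Summits.ResolutionOfSingularities.ResolutionOfSingularities.Theorems.ValuativeLuAlphaPTorsorDimTwoTransport
import Literature.AlgebraicGeometry.Resolution.QuadraticTransformsRegular
import Literature.AlgebraicGeometry.Resolution.QuadraticSequenceDimOneExistence
import Mathlib.Algebra.Field.Subfield.Basic
import HarnessLib

/-!
# Crux `Steer`, line `switching-dichotomy`: the quadratic sequence of the base (stub `stub_switchingSetup`)

For a base `A₀ ⊆ O` (a `k`-subalgebra of the valued field `(K, O)`), regular at the centre
`𝔪_O ∩ A₀` of the valuation ring `O` and containing a nonzero element of positive value, this file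
PROVES `stub_switchingSetup`: there is a sequence `R : ℕ → Subring K` with

* `R 0 = locAtCentre A₀.toSubring O = (A₀)_{𝔪_O ∩ A₀} ⊆ K`;
* every step `R i → R (i + 1)` is the quadratic transform along `O` (`IsQuadraticTransformAlong`);
* every member is a regular local ring, dominated by `O`;
* every member consists of fractions `y / z` of elements `y, z ∈ A₀`, `z ≠ 0`.

The argument (all ingredients already in the tree): `R 0` is regular by
`isRegularLocalRing_locAtCentre_iff` (it is `Localization.AtPrime (𝔪_O ∩ A₀)` up to isomorphism),
dominated by `O` (`subringDominates_locAtCentre`), and not a field (the given element `a ∈ A₀`,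
`a ≠ 0`, `v(a) > 0`, is a nonzero non-unit, `mem_maximalIdeal_locAtCentre_iff`); so the recursively
chosen sequence `quadraticSeq O (R 0)` IS an infinite sequence of quadratic transforms along `O`
(`isQuadraticTransformAlong_quadraticSeq_of_isRegularLocalRing`), its members are regular
(`isRegularLocalRing_sequence`, Abhyankar 1956, Prop. 8) and dominated (`sequence_dominates`).
Finally every member lies in the subfield `Frac A₀ = Subfield.closure A₀ ⊆ K`: `locAtCentre` and
`blowupRing` of a subring of a subfield stay inside it, and a quadratic transform along `O` is
`(R[𝔪_R/x])_{𝔪_O ∩ R[𝔪_R/x]}` (`IsQuadraticTransformAlong.exists_eq_locAtCentre`); elements of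
`Subfield.closure A₀` are fractions of elements of `A₀` (`Subfield.mem_closure_iff`).

Sources: S. S. Abhyankar, *On the valuations centered in a local domain*, Amer. J. Math. 78 (1956),
Prop. 8 and Lemma 12 (quadratic transforms along a valuation); S. D. Cutkosky, *Counterexamples to
local monomialization in positive characteristic*, Math. Ann. 362 (2015), §2.1–2.2.
-/

set_option linter.dupNamespace false

open IsLocalRing
open Literature.AlgebraicGeometry.Resolution

namespace Summit.ResolutionOfSingularities.ResolutionOfSingularities.Theorems.SwitchingDichotomy

/-! ## Subrings of a subfield: `locAtCentre`, `blowupRing`, quadratic transforms -/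

/-- `locAtCentre` of a subring of a subfield `F ⊆ K` lies in `F` (its elements are fractions
`y / z` with `y, z` in the subring). [folklore] -/
theorem locAtCentre_le_subfield {K : Type} [Field K] (O : ValuationSubring K) {B : Subring K}
    {F : Subfield K} (hB : B ≤ F.toSubring) : locAtCentre B O ≤ F.toSubring := by
  rintro _ ⟨y, hy, z, hz, -, rfl⟩
  exact F.div_mem (hB hy) (hB hz)

/-- The chart ring `R[𝔪_R/x]` of a local subring `R` of a subfield `F ⊆ K`, for `x ∈ F`, lies in
`F`. [folklore] -/
theorem blowupRing_le_subfield {K : Type} [Field K] {R : Subring K} [IsLocalRing R] {x : K}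
    {F : Subfield K} (hR : R ≤ F.toSubring) (hx : x ∈ F) : blowupRing R x ≤ F.toSubring := by
  refine Subring.closure_le.mpr ?_
  rintro z (hz | ⟨y, -, rfl⟩)
  · exact hR hz
  · exact F.div_mem (hR y.2) hx

/-- A quadratic transform along `O` of a subring of a subfield `F ⊆ K` lies in `F`: it is
`(R[𝔪_R/x])_{𝔪_O ∩ R[𝔪_R/x]}` for some `x ∈ 𝔪_R`. [folklore] -/
theorem le_subfield_of_isQuadraticTransformAlong {K : Type} [Field K] {O : ValuationSubring K}
    {R R₁ : Subring K} (h : IsQuadraticTransformAlong O R R₁) {F : Subfield K}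
    (hR : R ≤ F.toSubring) : R₁ ≤ F.toSubring := by
  obtain ⟨_, x, -, -, -, rfl⟩ := h.exists_eq_locAtCentre
  exact locAtCentre_le_subfield O (blowupRing_le_subfield hR (hR x.2))

/-- Along a sequence of quadratic transforms along `O`, if `R 0` lies in a subfield `F ⊆ K` then
so does every member. [folklore] -/
theorem sequence_le_subfield {K : Type} [Field K] {O : ValuationSubring K} {R : ℕ → Subring K}
    {F : Subfield K} (h0 : R 0 ≤ F.toSubring)
    (hstep : ∀ i, IsQuadraticTransformAlong O (R i) (R (i + 1))) (n : ℕ) :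
    R n ≤ F.toSubring := by
  induction n with
  | zero => exact h0
  | succ n ih => exact le_subfield_of_isQuadraticTransformAlong (hstep n) ih

/-- Elements of the subfield generated by a subring `B` are fractions `y / z` with `y, z ∈ B`,
`z ≠ 0`. [folklore] -/
theorem exists_div_eq_of_mem_subfieldClosure {K : Type} [Field K] {B : Subring K} {x : K}
    (hx : x ∈ Subfield.closure (B : Set K)) : ∃ y ∈ B, ∃ z ∈ B, z ≠ 0 ∧ x = y / z := by
  obtain ⟨y, hy, z, hz, rfl⟩ := Subfield.mem_closure_iff.mp hx
  rw [Subring.closure_eq] at hy hz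
  by_cases hz0 : z = 0
  · exact ⟨0, B.zero_mem, 1, B.one_mem, one_ne_zero, by rw [hz0, div_zero, zero_div]⟩
  · exact ⟨y, hy, z, hz, hz0, rfl⟩

/-! ## `locAtCentre B O` is not a field -/

/-- If `B ⊆ O` contains a nonzero element of positive value, then the local ring `B_{𝔪_O ∩ B}` is
not a field (that element is a nonzero member of the maximal ideal). [folklore] -/
theorem not_isField_locAtCentre {K : Type} [Field K] {B : Subring K} {O : ValuationSubring K}
    (h : B ≤ O.toSubring) {a : K} (haB : a ∈ B) (ha0 : a ≠ 0) (hva : O.valuation a < 1) :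
    ¬ IsField (locAtCentre B O) := by
  haveI := isLocalRing_locAtCentre h
  intro hF
  have hm : (⟨a, le_locAtCentre B O haB⟩ : locAtCentre B O) ∈ maximalIdeal (locAtCentre B O) :=
    (mem_maximalIdeal_locAtCentre_iff h _).mpr hva
  rw [IsLocalRing.isField_iff_maximalIdeal_eq.mp hF, Ideal.mem_bot] at hm
  exact ha0 (congrArg Subtype.val hm)

/-! ## The stub -/

/-- **The quadratic sequence of the base along `O`** (stub `stub_switchingSetup` of the line
`switching-dichotomy`): for `A₀ ⊆ O` regular at the centre of `O` and containing a nonzero element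
of positive value, the sequence `R = quadraticSeq O ((A₀)_{𝔪_O ∩ A₀})` starts at
`locAtCentre A₀.toSubring O`, each step is the quadratic transform along `O`, every member is a
regular local ring dominated by `O`, and every member consists of fractions of elements of `A₀`.
[folklore] -/
theorem stub_switchingSetup (k K : Type) [Field k] [Field K] [Algebra k K] (O : ValuationSubring K)
    (A₀ : Subalgebra k K) (h₀ : A₀.toSubring ≤ O.toSubring)
    (hreg : IsRegularLocalRing (Localization.AtPrime
      (Ideal.comap (Subring.inclusion h₀) (IsLocalRing.maximalIdeal O))))
    (ha : ∃ a ∈ A₀, a ≠ 0 ∧ O.valuation a < 1) :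
    ∃ R : ℕ → Subring K, R 0 = locAtCentre A₀.toSubring O ∧
      (∀ i, IsQuadraticTransformAlong O (R i) (R (i + 1))) ∧ (∀ i, IsRegularLocalRing (R i)) ∧
      (∀ i, SubringDominates (R i) O.toSubring) ∧
      ∀ i, ∀ x ∈ R i, ∃ y ∈ A₀, ∃ z ∈ A₀, z ≠ 0 ∧ x = y / z := by
  obtain ⟨a, haA, ha0, hva⟩ := ha
  -- the starting ring `R₀ = (A₀)_{𝔪_O ∩ A₀} ⊆ K`
  have hreg₀ : IsRegularLocalRing (locAtCentre A₀.toSubring O) :=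
    (isRegularLocalRing_locAtCentre_iff h₀).mpr hreg
  have hnf₀ : ¬ IsField (locAtCentre A₀.toSubring O) :=
    not_isField_locAtCentre h₀ (B := A₀.toSubring) haA ha0 hva
  have hdom₀ : SubringDominates (locAtCentre A₀.toSubring O) O.toSubring :=
    subringDominates_locAtCentre h₀
  -- the sequence of quadratic transforms along `O`
  have hstep : ∀ i, IsQuadraticTransformAlong O (quadraticSeq O (locAtCentre A₀.toSubring O) i)
      (quadraticSeq O (locAtCentre A₀.toSubring O) (i + 1)) :=
    Summit.ResolutionOfSingularities.ResolutionOfSingularities.Theorems.PfaffLine.isQuadraticTransformAlong_quadraticSeq_of_isRegularLocalRing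
      hreg₀ hnf₀ hdom₀
  -- every member lies in the subfield `Frac A₀ ⊆ K`
  have hF0 : quadraticSeq O (locAtCentre A₀.toSubring O) 0 ≤
      (Subfield.closure (A₀ : Set K)).toSubring :=
    locAtCentre_le_subfield O fun x hx => Subfield.subset_closure hx
  refine ⟨quadraticSeq O (locAtCentre A₀.toSubring O), rfl, hstep,
    isRegularLocalRing_sequence hreg₀ hstep, fun i => (sequence_dominates hdom₀ hstep i).1,
    fun i x hx => ?_⟩
  have hxF : x ∈ Subfield.closure ((A₀.toSubring : Subring K) : Set K) :=
    sequence_le_subfield hF0 hstep i hx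
  exact exists_div_eq_of_mem_subfieldClosure hxF

end Summit.ResolutionOfSingularities.ResolutionOfSingularities.Theorems.SwitchingDichotomy
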